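import Mathlib
import Summits.ABC.IUTFork.Joshi.ThetaValuesLocus
import Summits.ABC.IUTFork.Joshi.LocalPeriodRingsModelRoots
import HarnessLib

/-!
# A kernel MODEL of E-t3's `PeriodRingDatum` with an INTEGRAL DOMAIN `B` and a genuine Frobenius eigenvector — the base of the
# joint §5–§6 vacuity model for slot T-09's `PeriodRingTower` (branch E, E-plan-2 ruling 2026-08-26T08:36:44Z (2))

Test-side support file of the abc-iut cell, branch E (rung LADDER-ABC:A2.E; seat abc-iut-E-t9). PURPOSE. E-t3's O1 model
`Model.periodRingDatum` (`Joshi/TestThetaValuesLocusModel.lean`) realises the signature with `B := (Q̄_p → Q̄_p)` and `φ = id`; it cannot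
be extended to the §5 tower `PeriodRingTower` (p429989) for two reasons that are Joshi's own structure, not artefacts: (5.2.4.2)
`B ↪ B_dR` with `B_dR` a field forces `B` to be an integral domain, and `φ(t) = p·t` with `t ≠ 0` ([FF18] 10.1.1) forces `φ ≠ id`.
This file gives a second model of the SAME signature `Summit.ABC.IUTFork.Joshi.PeriodRingDatum` meeting both constraints, over which
`Joshi/LocalPeriodRingsModelTower.lean` instantiates `PeriodRingTower` and `BEDatum`. The model is LOGICAL, not arithmetic (as for
O1: the «tilt» `F` is `Q̄_p`, characteristic `0`); it shows only that the typed axioms are jointly satisfiable. NOTHING here is a claim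
about Joshi's or Mochizuki's mathematics; no side taken.

DICTIONARY OF CHOICES (`K := Q̄_p = PadicAlgCl p` with its spectral norm; `Χ : ℚ → Kˣ` the character of
`LocalPeriodRingsModelRoots`, `‖Χ(q)‖ = ‖p‖^q`):
* `B := A[S]`, polynomials over the group algebra `A := K[ℚ]` (monomials `T^q`, `q ∈ ℚ`) — an integral domain;
* `F := K`, `|·|_F := ‖·‖`; Teichmüller map `[x] := C(T^{ι(x)} · u(x))` with `ι(x) = log‖x‖/log‖p‖ ∈ ℚ` (`= −normExp x`) and the
  unit part `u(x) = x / Χ(ι(x))` (norm `1`);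
* norms `|f|_ρ := ‖p‖^{ord_ℚ(f(S=0))}` (the `T`-adic order of the constant-in-`S` coefficient; independent of `ρ`; constants of `K`
  have norm `1`, so `ℚ_p ⊂ B⁺` as §5.2.1 requires);
* `Y := ℚ` (twist exponents), `K_y := K` with `|·|_{K_y} := ‖·‖^{e_y}`, `e_y = y` for `y > 0` (else `1`); residue maps
  `η_y : B → K`, `T^q ↦ Χ(q / e_y)`, `S ↦ 0`; so `|η_y([x])|_{K_y} = (‖p‖^{ι(x)/e_y})^{e_y} = ‖x‖` (A1) and every `ξ` is an `η_y([x])`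
  (A2, explicit preimage); `pt(a) := ι(a)` so that `|p|_{K_{pt a}} = ‖p‖^{ι(a)} = ‖a‖` (A4);
* `φ := (S ↦ p·S)` (an `A`-algebra automorphism; `φ` fixes the constant-in-`S` coefficient, so `B⁺` is `φ`-stable), Galois trivial
  (`G := Unit`), `T_y := {0}`, `E0 := K` with `|·|_0 := ‖·‖`, `ι_y := id`, `scale y := e_y`, Frobenius on points `y ↦ p·y`.
The element `t := S` (file 3) then satisfies `φ(t) = p·t`, `t ≠ 0`. [folklore]
-/

noncomputable section

open Polynomial

namespace Summit.ABC.IUTFork.Joshi.Model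

variable (p : ℕ) [hp : Fact p.Prime]

/-- `A := Q̄_p[ℚ]`, the group algebra of `ℚ` (monomials `T^q`). [folklore] -/
abbrev ExpAlg : Type := AddMonoidAlgebra (PadicAlgCl p) ℚ

/-- `B := A[S]`. [folklore] -/
abbrev TowerRing : Type := Polynomial (ExpAlg p)

/-! ## 1. Exponents and unit parts in `Q̄_p` -/

/-- Local copy: `‖p‖ = p⁻¹` in `Q̄_p`. [folklore] -/
private theorem norm_p' : ‖(p : PadicAlgCl p)‖ = (p : ℝ)⁻¹ := by
  rw [← map_natCast (algebraMap ℚ_[p] (PadicAlgCl p)), ← PadicAlgCl.coe_eq]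
  show ‖((p : ℚ_[p]) : PadicAlgCl p)‖ = _
  rw [PadicAlgCl.norm_extends, Padic.norm_p]

/-- Local copy: `0 < ‖p‖ < 1`. [folklore] -/
private theorem norm_p_pos_lt_one' : 0 < ‖(p : PadicAlgCl p)‖ ∧ ‖(p : PadicAlgCl p)‖ < 1 := by
  have h1 : (1 : ℝ) < p := by exact_mod_cast hp.out.one_lt
  rw [norm_p']
  exact ⟨inv_pos.2 (lt_trans one_pos h1), inv_lt_one_of_one_lt₀ h1⟩

/-- The exponent `ι(x) := log‖x‖ / log‖p‖ = −normExp x ∈ ℚ` (`0` at `x = 0`). [folklore] -/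
def iota (x : PadicAlgCl p) : ℚ := -normExp p x

/-- `ι(0) = 0`. [folklore] -/
theorem iota_zero : iota p 0 = 0 := by simp [iota, normExp]

/-- `‖x‖ = ‖p‖^{ι(x)}` for `x ≠ 0`. [folklore] -/
theorem norm_eq_rpow_iota {x : PadicAlgCl p} (hx : x ≠ 0) :
    ‖x‖ = ‖(p : PadicAlgCl p)‖ ^ ((iota p x : ℚ) : ℝ) := by
  have h0 : (0 : ℝ) < p := by exact_mod_cast hp.out.pos
  rw [norm_eq_rpow_normExp p hx, norm_p', iota, Rat.cast_neg, Real.rpow_neg (inv_pos.2 h0).le,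
    Real.inv_rpow h0.le, inv_inv]

/-- The exponent is determined by the norm: `‖x‖ = ‖p‖^q ⇒ ι(x) = q`. [folklore] -/
theorem iota_eq_of_norm {x : PadicAlgCl p} (hx : x ≠ 0) {q : ℚ} (h : ‖x‖ = ‖(p : PadicAlgCl p)‖ ^ ((q : ℚ) : ℝ)) :
    iota p x = q := by
  have hp0 := (norm_p_pos_lt_one' p).1
  have hlog : Real.log ‖(p : PadicAlgCl p)‖ ≠ 0 := (Real.log_neg hp0 (norm_p_pos_lt_one' p).2).ne
  rw [norm_eq_rpow_iota p hx] at h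
  have h' := congrArg Real.log h
  rw [Real.log_rpow hp0, Real.log_rpow hp0] at h'
  exact_mod_cast mul_right_cancel₀ hlog h'

/-- `0 < ι(x)` when `0 < ‖x‖ < 1`. [folklore] -/
theorem iota_pos {x : PadicAlgCl p} (hx : x ≠ 0) (h1 : ‖x‖ < 1) : 0 < iota p x := by
  by_contra h
  push Not at h
  have : (1 : ℝ) ≤ ‖x‖ := by
    rw [norm_eq_rpow_iota p hx]
    exact Real.one_le_rpow_of_pos_of_le_one_of_nonpos (norm_p_pos_lt_one' p).1 (norm_p_pos_lt_one' p).2.le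
      (by exact_mod_cast h)
  linarith

/-- The unit part `u(x) := x / Χ(ι(x))`. [folklore] -/
def unitPart (x : PadicAlgCl p) : PadicAlgCl p := x / chi p (Multiplicative.ofAdd (iota p x))

/-- `u(0) = 0`. [folklore] -/
theorem unitPart_zero : unitPart p 0 = 0 := by simp [unitPart]

/-- `‖u(x)‖ = 1` for `x ≠ 0`. [folklore] -/
theorem norm_unitPart {x : PadicAlgCl p} (hx : x ≠ 0) : ‖unitPart p x‖ = 1 := by
  rw [unitPart, norm_div, norm_chi, ← norm_eq_rpow_iota p hx, div_self (norm_ne_zero_iff.2 hx)]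

/-- `u(x) ≠ 0` for `x ≠ 0`. [folklore] -/
theorem unitPart_ne_zero {x : PadicAlgCl p} (hx : x ≠ 0) : unitPart p x ≠ 0 :=
  div_ne_zero hx (chi_ne_zero p _)

/-- `u(x) · Χ(ι(x)) = x`. [folklore] -/
theorem unitPart_mul_chi (x : PadicAlgCl p) : unitPart p x * chi p (Multiplicative.ofAdd (iota p x)) = x :=
  div_mul_cancel₀ x (chi_ne_zero p _)

/-! ## 2. The ring `B = Q̄_p[ℚ][S]`, the Teichmüller map, the norm, the Frobenius -/

/-- The Teichmüller map `[x] := C(T^{ι(x)} · u(x))` (`[0] = 0`). [folklore] -/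
def teichB (x : PadicAlgCl p) : TowerRing p := C (AddMonoidAlgebra.single (iota p x) (unitPart p x))

/-- The support of a nonzero element of `A` is nonempty. [folklore] -/
theorem coeff_support_nonempty {a : ExpAlg p} (h : a ≠ 0) : a.coeff.support.Nonempty :=
  Finsupp.support_nonempty_iff.2 (by rwa [Ne, AddMonoidAlgebra.coeff_eq_zero])

open scoped Classical in
/-- The `T`-adic order norm on `A = Q̄_p[ℚ]`: `‖p‖^{min supp a}` for `a ≠ 0`, `0` at `0`. [folklore] -/
def ordNorm (a : ExpAlg p) : ℝ :=
  if h : a = 0 then 0 else ‖(p : PadicAlgCl p)‖ ^ (((a.coeff.support.min' (coeff_support_nonempty p h)) : ℚ) : ℝ)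

/-- `ordNorm 0 = 0`. [folklore] -/
theorem ordNorm_zero : ordNorm p 0 = 0 := by simp [ordNorm]

/-- `0 ≤ ordNorm a`. [folklore] -/
theorem ordNorm_nonneg (a : ExpAlg p) : 0 ≤ ordNorm p a := by
  unfold ordNorm; split_ifs
  · exact le_rfl
  · exact Real.rpow_nonneg (norm_nonneg _) _

/-- `ordNorm (T^q · c) = ‖p‖^q` for `c ≠ 0`. [folklore] -/
theorem ordNorm_single (q : ℚ) {c : PadicAlgCl p} (hc : c ≠ 0) :
    ordNorm p (AddMonoidAlgebra.single q c) = ‖(p : PadicAlgCl p)‖ ^ ((q : ℚ) : ℝ) := by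
  have hne : (AddMonoidAlgebra.single q c : ExpAlg p) ≠ 0 := AddMonoidAlgebra.single_ne_zero.2 hc
  unfold ordNorm
  rw [dif_neg hne]
  congr 2
  have hs : (AddMonoidAlgebra.single q c : ExpAlg p).coeff.support = {q} := by
    rw [AddMonoidAlgebra.coeff_single]; exact Finsupp.support_single _ hc
  simp_rw [hs]
  exact Finset.min'_singleton q

/-- If `a ≠ 0` and `m ∈ supp a` then `ordNorm a ≥ ‖p‖^m` (the base is `< 1`). [folklore] -/
theorem rpow_le_ordNorm {a : ExpAlg p} (ha : a ≠ 0) {m : ℚ} (hm : m ∈ a.coeff.support) :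
    ‖(p : PadicAlgCl p)‖ ^ ((m : ℚ) : ℝ) ≤ ordNorm p a := by
  unfold ordNorm
  rw [dif_neg ha]
  exact Real.rpow_le_rpow_of_exponent_ge (norm_p_pos_lt_one' p).1 (norm_p_pos_lt_one' p).2.le
    (by exact_mod_cast Finset.min'_le _ _ hm)

/-- **The order norm is ultrametric.** [folklore] -/
theorem ordNorm_add_le (a b : ExpAlg p) : ordNorm p (a + b) ≤ max (ordNorm p a) (ordNorm p b) := by
  by_cases hab : a + b = 0
  · rw [hab, ordNorm_zero]; exact le_max_of_le_left (ordNorm_nonneg p a)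
  · have hne : (a + b).coeff.support.Nonempty := coeff_support_nonempty p hab
    set m := (a + b).coeff.support.min' hne with hm
    have hmem : m ∈ (a + b).coeff.support := Finset.min'_mem _ _
    have hval : ordNorm p (a + b) = ‖(p : PadicAlgCl p)‖ ^ ((m : ℚ) : ℝ) := by
      unfold ordNorm; rw [dif_neg hab]
    rw [hval]
    have hmem' : m ∈ (a.coeff + b.coeff).support := by rwa [← AddMonoidAlgebra.coeff_add]
    have hunion := Finsupp.support_add hmem'
    rcases Finset.mem_union.1 hunion with h | h
    · have ha : a ≠ 0 := fun h0 => by rw [h0, AddMonoidAlgebra.coeff_zero, Finsupp.support_zero] at h; simp at h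
      exact le_max_of_le_left (rpow_le_ordNorm p ha h)
    · have hb : b ≠ 0 := fun h0 => by rw [h0, AddMonoidAlgebra.coeff_zero, Finsupp.support_zero] at h; simp at h
      exact le_max_of_le_right (rpow_le_ordNorm p hb h)

/-- The norms `|f|_ρ := ordNorm (f(S = 0))` on `B` (independent of `ρ`). [folklore] -/
def normB (_ρ : ℝ) (f : TowerRing p) : ℝ := ordNorm p (f.coeff 0)

/-- `|[x]|_ρ = ‖x‖`. [folklore] -/
theorem normB_teichB (ρ : ℝ) (x : PadicAlgCl p) : normB p ρ (teichB p x) = ‖x‖ := by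
  by_cases hx : x = 0
  · rw [hx, teichB, unitPart_zero, AddMonoidAlgebra.single_zero, map_zero, normB, coeff_zero, ordNorm_zero, norm_zero]
  · rw [normB, teichB, coeff_C_zero, ordNorm_single p _ (unitPart_ne_zero p hx), norm_eq_rpow_iota p hx]

/-- `p⁻¹ ∈ A` as the constant monomial `T⁰ · p⁻¹`. [folklore] -/
def pInvA : ExpAlg p := AddMonoidAlgebra.single 0 ((p : PadicAlgCl p)⁻¹)

/-- `p · p⁻¹ = 1` in `B`. [folklore] -/
theorem natCast_mul_C_pInvA : (p : TowerRing p) * C (pInvA p) = 1 := by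
  have hp0 : (p : PadicAlgCl p) ≠ 0 := by exact_mod_cast hp.out.ne_zero
  have hA : (p : ExpAlg p) * pInvA p = 1 := by
    rw [AddMonoidAlgebra.natCast_def, pInvA, AddMonoidAlgebra.single_mul_single, zero_add, mul_inv_cancel₀ hp0,
      AddMonoidAlgebra.one_def]
  rw [← map_natCast (C : ExpAlg p →+* TowerRing p), ← map_mul, hA, map_one]

/-- `p⁻¹ · p = 1` in `B`. [folklore] -/
theorem C_pInvA_mul_natCast : C (pInvA p) * (p : TowerRing p) = 1 := by
  rw [mul_comm, natCast_mul_C_pInvA]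

/-- `φ := (S ↦ p·S)` as an `A`-algebra endomorphism. [folklore] -/
def frobHom : TowerRing p →ₐ[ExpAlg p] TowerRing p := aeval ((p : TowerRing p) * X)

/-- `φ⁻¹ := (S ↦ p⁻¹·S)`. [folklore] -/
def frobInv : TowerRing p →ₐ[ExpAlg p] TowerRing p := aeval (C (pInvA p) * X)

/-- `φ ∘ φ⁻¹ = id`. [folklore] -/
theorem frobHom_comp_frobInv : (frobHom p).comp (frobInv p) = AlgHom.id (ExpAlg p) (TowerRing p) := by
  refine Polynomial.algHom_ext ?_
  simp only [frobHom, frobInv, AlgHom.comp_apply, aeval_X, AlgHom.id_apply, map_mul, aeval_C,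
    Polynomial.algebraMap_eq]
  rw [← mul_assoc, C_pInvA_mul_natCast, one_mul]

/-- `φ⁻¹ ∘ φ = id`. [folklore] -/
theorem frobInv_comp_frobHom : (frobInv p).comp (frobHom p) = AlgHom.id (ExpAlg p) (TowerRing p) := by
  refine Polynomial.algHom_ext ?_
  simp only [frobHom, frobInv, AlgHom.comp_apply, aeval_X, AlgHom.id_apply, map_mul, map_natCast]
  rw [← mul_assoc, natCast_mul_C_pInvA, one_mul]

/-- **The Frobenius `φ : B ≃ₐ[A] B`, `S ↦ p·S`.** [folklore] -/
def frobEquivA : TowerRing p ≃ₐ[ExpAlg p] TowerRing p :=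
  AlgEquiv.ofAlgHom (frobHom p) (frobInv p) (frobHom_comp_frobInv p) (frobInv_comp_frobHom p)

/-- `φ(f) = f(p·S)`. [folklore] -/
theorem frobEquivA_apply (f : TowerRing p) : frobEquivA p f = aeval ((p : TowerRing p) * X) f := rfl

/-- `φ(S) = p·S`. [folklore] -/
theorem frobEquivA_X : frobEquivA p X = (p : TowerRing p) * X := by
  rw [frobEquivA_apply, aeval_X]

/-- `φ` fixes the constant-in-`S` coefficient. [folklore] -/
theorem coeff_zero_frobEquivA (f : TowerRing p) : (frobEquivA p f).coeff 0 = f.coeff 0 := by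
  rw [frobEquivA_apply, ← comp_eq_aeval, coeff_zero_eq_eval_zero, eval_comp, coeff_zero_eq_eval_zero]
  simp

/-- Hence `φ` preserves the norms `|·|_ρ`. [folklore] -/
theorem normB_frobEquivA (ρ : ℝ) (f : TowerRing p) : normB p ρ (frobEquivA p f) = normB p ρ f := by
  rw [normB, normB, coeff_zero_frobEquivA]

/-! ## 3. Twists, residue maps and the signature fields -/

/-- The twist exponent `e_y` (`= y` for `y > 0`, else `1`), as a rational. [folklore] -/
def eRat (y : ℚ) : ℚ := if 0 < y then y else 1

/-- `0 < e_y`. [folklore] -/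
theorem eRat_pos (y : ℚ) : 0 < eRat y := by unfold eRat; split_ifs with h; exact h; exact one_pos

/-- `0 < e_y` as a real. [folklore] -/
theorem eRat_pos_real (y : ℚ) : (0 : ℝ) < (eRat y : ℚ) := by exact_mod_cast eRat_pos y

/-- The scaled character `q ↦ Χ(q / e_y)` as a monoid homomorphism. [folklore] -/
def chiScaled (y : ℚ) : Multiplicative ℚ →* PadicAlgCl p :=
  (chi p).comp (AddMonoidHom.toMultiplicative (AddMonoidHom.mulRight (eRat y)⁻¹))

/-- `chiScaled y q = Χ(q / e_y)`. [folklore] -/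
theorem chiScaled_apply (y q : ℚ) :
    chiScaled p y (Multiplicative.ofAdd q) = chi p (Multiplicative.ofAdd (q / eRat y)) := by
  rfl

/-- The residue map on `A`: `T^q ↦ Χ(q/e_y)`. [folklore] -/
def etaA (y : ℚ) : ExpAlg p →+* PadicAlgCl p :=
  (AddMonoidAlgebra.lift (PadicAlgCl p) (PadicAlgCl p) ℚ (chiScaled p y)).toRingHom

/-- `etaA y (T^q · c) = c · Χ(q/e_y)`. [folklore] -/
theorem etaA_single (y q : ℚ) (c : PadicAlgCl p) :
    etaA p y (AddMonoidAlgebra.single q c) = c * chi p (Multiplicative.ofAdd (q / eRat y)) := by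
  change AddMonoidAlgebra.lift (PadicAlgCl p) (PadicAlgCl p) ℚ (chiScaled p y) (AddMonoidAlgebra.single q c) = _
  rw [AddMonoidAlgebra.lift_single, chiScaled_apply, smul_eq_mul]

/-- The residue map `η_y : B → Q̄_p`, `S ↦ 0`, `T^q ↦ Χ(q/e_y)`. [folklore] -/
def etaB (y : ℚ) : TowerRing p →+* PadicAlgCl p := eval₂RingHom (etaA p y) 0

/-- `η_y([x]) = u(x) · Χ(ι(x)/e_y)`. [folklore] -/
theorem etaB_teichB (y : ℚ) (x : PadicAlgCl p) :
    etaB p y (teichB p x) = unitPart p x * chi p (Multiplicative.ofAdd (iota p x / eRat y)) := by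
  rw [etaB, teichB, coe_eval₂RingHom, eval₂_C, etaA_single]

/-- **(A1)** `|η_y([x])|^{e_y}… = ‖x‖`: `‖η_y([x])‖^{e_y} = ‖x‖`. [folklore] -/
theorem norm_etaB_teichB_rpow (y : ℚ) (x : PadicAlgCl p) :
    ‖etaB p y (teichB p x)‖ ^ ((eRat y : ℚ) : ℝ) = ‖x‖ := by
  have he : ((eRat y : ℚ) : ℝ) ≠ 0 := (eRat_pos_real y).ne'
  by_cases hx : x = 0
  · rw [hx, etaB_teichB, unitPart_zero, zero_mul, norm_zero, Real.zero_rpow he]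
  · rw [etaB_teichB, norm_mul, norm_unitPart p hx, one_mul, norm_chi, ← Real.rpow_mul (norm_nonneg _),
      Rat.cast_div, div_mul_cancel₀ _ he, ← norm_eq_rpow_iota p hx]

/-- **(A2)** every `ξ` is an `η_y([x])`: explicit preimage `x = ξ · Χ(j)/Χ(j/e_y)`, `j = e_y·ι(ξ)`. [folklore] -/
theorem exists_etaB_teichB_eq (y : ℚ) (ξ : PadicAlgCl p) : ∃ x : PadicAlgCl p, etaB p y (teichB p x) = ξ := by
  by_cases hξ : ξ = 0
  · exact ⟨0, by rw [hξ, etaB_teichB, unitPart_zero, zero_mul]⟩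
  · set j : ℚ := eRat y * iota p ξ with hj
    set x : PadicAlgCl p := ξ * chi p (Multiplicative.ofAdd j) / chi p (Multiplicative.ofAdd (j / eRat y)) with hxdef
    have he : (eRat y : ℝ) ≠ 0 := (eRat_pos_real y).ne'
    have hx0 : x ≠ 0 := div_ne_zero (mul_ne_zero hξ (chi_ne_zero p _)) (chi_ne_zero p _)
    have hnormx : ‖x‖ = ‖(p : PadicAlgCl p)‖ ^ ((j : ℚ) : ℝ) := by
      have hp0 := (norm_p_pos_lt_one' p).1
      rw [hxdef, norm_div, norm_mul, norm_chi, norm_chi, norm_eq_rpow_iota p hξ, ← Real.rpow_add hp0,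
        ← Real.rpow_sub hp0]
      congr 1
      rw [hj]; push_cast; field_simp; ring
    have hιx : iota p x = j := iota_eq_of_norm p hx0 hnormx
    refine ⟨x, ?_⟩
    rw [etaB_teichB, hιx, unitPart, hιx, hxdef]
    field_simp [chi_ne_zero p (Multiplicative.ofAdd j), chi_ne_zero p (Multiplicative.ofAdd (j / eRat y))]

/-- **(A4)** at the point `pt a = ι(a)` (`0 < ‖a‖ < 1`): `‖p‖^{e_{ι a}} = ‖a‖`. [folklore] -/
theorem norm_p_rpow_eRat_iota {a : PadicAlgCl p} (ha : a ≠ 0) (h1 : ‖a‖ < 1) :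
    ‖(p : PadicAlgCl p)‖ ^ ((eRat (iota p a) : ℚ) : ℝ) = ‖a‖ := by
  rw [eRat, if_pos (iota_pos p ha h1), ← norm_eq_rpow_iota p ha]

/-- `ι(a^p) = p · ι(a)` (Frobenius on points is `y ↦ p·y`). [folklore] -/
theorem iota_pow_p (a : PadicAlgCl p) : iota p (a ^ p) = (p : ℚ) * iota p a := by
  by_cases ha : a = 0
  · rw [ha, zero_pow hp.out.ne_zero, iota_zero, mul_zero]
  · refine iota_eq_of_norm p (pow_ne_zero _ ha) ?_
    rw [norm_pow, norm_eq_rpow_iota p ha, ← Real.rpow_natCast, ← Real.rpow_mul (norm_nonneg _)]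
    push_cast; ring_nf

/-! ## 4. The model of `PeriodRingDatum` -/

/-- **The second model of E-t3's period-ring signature** — `B = Q̄_p[ℚ][S]` an integral domain, Frobenius `S ↦ p·S` (see the
module docstring for the dictionary of choices). [folklore] -/
def towerDatum : PeriodRingDatum (PadicAlgCl p) (TowerRing p) (PadicAlgCl p) ℚ (fun _ => PadicAlgCl p) Unit where
  p := p
  p_prime := hp.out
  absF := absOne p
  norm := normB p
  norm_nonneg _ f := ordNorm_nonneg p _
  norm_add_le _ f g := by
    show ordNorm p ((f + g).coeff 0) ≤ max (ordNorm p (f.coeff 0)) (ordNorm p (g.coeff 0))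
    rw [coeff_add]; exact ordNorm_add_le p _ _
  teich := teichB p
  norm_teich ρ x _ _ := by rw [normB_teichB, absOne_apply]
  gal _ := id
  frob := frobEquivA p
  gal_norm_one _ _ h := h
  frob_norm_one x h := by show normB p 1 (frobEquivA p x) ≤ 1; rwa [normB_frobEquivA]
  absK y := absPow p ((eRat y : ℚ) : ℝ) (eRat_pos_real y)
  eta := etaB p
  absK_eta_teich y x := by rw [absPow_apply, absOne_apply]; exact norm_etaB_teichB_rpow p y x
  exists_teich_lift y ξ _ := exists_etaB_teichB_eq p y ξ
  T _ := {0}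
  zero_mem_T _ := rfl
  eta_T y τ hτ := by rw [Set.mem_singleton_iff.1 hτ, map_zero]
  T_norm_one y τ hτ := by
    rw [Set.mem_singleton_iff.1 hτ]
    show ordNorm p ((0 : TowerRing p).coeff 0) ≤ 1
    rw [coeff_zero, ordNorm_zero]; exact zero_le_one
  pt := iota p
  frobY y := (p : ℚ) * y
  pt_frob a := iota_pow_p p a
  galF _ := RingHom.id _
  absF_galF _ _ := rfl
  galY _ := id
  pt_gal _ _ := rfl
  abs0 := absOne p
  abs0_p := by rw [absOne_apply]; exact norm_p_pos_lt_one' p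
  emb _ := RingHom.id _
  scale y := ((eRat y : ℚ) : ℝ)
  scale_pos y := eRat_pos_real y
  absK_emb y z := by rw [absPow_apply, absOne_apply]; rfl
  absK_pt a ha0 ha1 := by
    rw [absOne_apply] at ha1 ⊢
    rw [absPow_apply]
    exact norm_p_rpow_eRat_iota p ha0 ha1

/-- Unfolding: the model's Frobenius IS `frobEquivA`. [folklore] -/
theorem towerDatum_frob (x : TowerRing p) : (towerDatum p).frob x = frobEquivA p x := rfl

/-- Unfolding: the model's norm IS `normB`. [folklore] -/
theorem towerDatum_norm (ρ : ℝ) (x : TowerRing p) : (towerDatum p).norm ρ x = normB p ρ x := rfl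

/-- Unfolding: `B⁺ = {f : ordNorm (f(S=0)) ≤ 1}`; in particular every CONSTANT `C (T⁰·c)` and `S` itself lie in `B⁺`. [folklore] -/
theorem mem_Bplus_iff (f : TowerRing p) : f ∈ (towerDatum p).Bplus ↔ ordNorm p (f.coeff 0) ≤ 1 := Iff.rfl

/-- `S ∈ B⁺` (its constant coefficient is `0`). [folklore] -/
theorem X_mem_Bplus : (X : TowerRing p) ∈ (towerDatum p).Bplus := by
  rw [mem_Bplus_iff, coeff_X_zero, ordNorm_zero]; exact zero_le_one

/-- Constants `T⁰·c` (`c ∈ Q̄_p`) lie in `B⁺` (norm `1` or `0`) — so `ℚ_p ⊂ B⁺`, as [J-III] §5.2.1 requires. [folklore] -/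
theorem C_single_zero_mem_Bplus (c : PadicAlgCl p) : C (AddMonoidAlgebra.single 0 c) ∈ (towerDatum p).Bplus := by
  rw [mem_Bplus_iff, coeff_C_zero]
  by_cases hc : c = 0
  · rw [hc, AddMonoidAlgebra.single_zero, ordNorm_zero]; exact zero_le_one
  · rw [ordNorm_single p 0 hc, Rat.cast_zero, Real.rpow_zero]

/-- **Non-vacuity of the signature by a domain**: the carrier `B` of `towerDatum` is an integral domain. [folklore] -/
theorem towerRing_isDomain : IsDomain (TowerRing p) := inferInstance

end Summit.ABC.IUTFork.Joshi.Model

end
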